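import Summits.AtomisticToContinuum.FouriersLaw.Theses.CageBudgetFekete
import Literature.MathematicalPhysics.KineticTheory.InfiniteChainObservables
import Literature.MathematicalPhysics.KineticTheory.InfiniteChainGibbsExistenceShift
import Literature.MathematicalPhysics.KineticTheory.InfiniteChainShiftInvariantUniqueness
import Literature.MathematicalPhysics.KineticTheory.InfiniteChainSuperstableReversal
import Literature.MathematicalPhysics.KineticTheory.InfiniteChainPartialMomentumReversal
import Summits.AtomisticToContinuum.FouriersLaw.Theorems.EmbeddedDrudeMourreGreenKuboContinuationBmFlowInvariant
import Summits.AtomisticToContinuum.FouriersLaw.Theorems.EmbeddedDrudeMourreGreenKuboContinuationCurrentVariancePos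

/-!
# Disproof of `HeatVarianceCalculus` (crux stmt-AtomisticToContinuum-15772, route CageBudgetFekete) — findings

**STATUS (cdisprove cycle 1, 2026-08-17): NO KILL IS POSSIBLE — the crux is a theorem.**
The line `canonical-rigidity` (Cruxes/HeatVarianceCalculus/Lines/canonical_rigidity.lean) is
proof-complete: `HeatVarianceCalculusComplete.lean` (this directory) proves the crux BY NAME,
sorry-free, axioms `propext / Classical.choice / Quot.sound` (re-checked from several seats), and its two
stubs are LANDED (`p157777` `…Theorems/CageBudgetFeketeHeatVarianceCalculusLaplace.lean`,
`p157834` `…Theorems/CageBudgetFeketeHeatVarianceCalculusCanonicalMajorant.lean`, both ACCEPTED).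
So every counterexample search below necessarily fails; what this file records, as Lean, is the
LOAD-BEARING ANALYSIS of the hypotheses — which guard is doing the work — for the planners of the
sibling cruxes `QuasiSuperadditiveHeatVariance` / `HeatVarianceCeiling` / `UnboundedHeatVariance`
(same arena, verbatim) and of the sibling routes CoercivePulse / CurrentTiltQuench.

## Findings

* §1 `junkDynamics P` — the CARRIER-FREE junk inhabitant of `InfiniteChainDynamics P`:
  `carrier = ∅`, `φ₀ = id`, `φ_t = R` (momentum reversal) for `t ≠ 0`. Every field of the structure
  holds vacuously; for an `R`-invariant state EVERY `φ_t` is measure preserving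
  (`junk_measurePreserving`) and `φ_t ∘ shift = shift ∘ φ_t` holds EVERYWHERE (`junk_shift_comm`).
  Its summed correlation is `C(0) = C₀ := ∑_x ∫ j_0 j_x dμ` and `C(t) = -C₀` for `t ≠ 0`
  (`junk_currentCorrelation_zero/ne`).
* §2 `static_sum_pos` — for the (unique) shift-invariant DLR state of `pinnedChain` at any `T > 0`,
  `0 < C₀` (from the landed `currentCorrelation_zero_pos` transported through the landed
  Buttà–Marchioro dynamics `exists_bmDynamics_pinnedChain`; equivalently `C₀ = (T/4)∫(V'(r₀)+V'(r₁))²`).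
* §3 LOAD-BEARING: `HeatVarianceCalculusWithoutCarrierAE` = the crux with `D.PreservesMeasure μ`
  WEAKENED to `∀ t, MeasurePreserving (D.flow t) μ μ` (i.e. only the clause
  `∀ᵐ σ ∂μ, σ ∈ D.carrier` dropped) is FALSE: `heatVarianceCalculus_false_without_carrierAE`
  (witness: the shift-invariant DLR state at `ω₂ = lam = β = T = 1`, `γ = 0`, which is `R`-invariant by
  uniqueness, and `junkDynamics`; clause (b) fails: `C` jumps from `C₀ > 0` to `-C₀` at `t = 0`).
  Corollary `heatVarianceCalculus_false_without_preservesMeasure` (hypothesis dropped entirely).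
  READING: any proof must use `hD.1 : ∀ᵐ σ ∂μ, σ ∈ D.carrier` — it is the only hypothesis tying the
  abstract flow to the equations of motion on a set the measure sees; the landed proof uses it exactly
  once, in the rigidity lemma `flow_ae_eq_canonical` (a.e. orbit ⊆ bmGood ⇒ `φ_t = Φ_BM` a.e.).
  The same junk also breaks clause (c): `V(1) = -C₀ < 0` (`junk_heatVariance_one_neg`), so positivity of
  the heat variance is a property of the Koopman group (positive type), not of the static Gibbs data.
  LANDING: the def-free, importable form of §1–§3 is proposed as
  `Summits/AtomisticToContinuum/FouriersLaw/Theorems/HeatVarianceCalculus/Negative/LoadBearing.lean`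
  (`static_sum_pos`, `map_momentumReversalZ_eq`, `exists_pseudoDynamics`,
  `heatVarianceCalculus_false_without_carrierAE`, `heatVarianceCalculus_false_without_preservesMeasure`,
  `exists_pseudoDynamics_heatVariance_neg`; `--supports stmt-AtomisticToContinuum-15772`).
* §4 NOT load-bearing / idle (information only; positive statements are the provers' to land):
  `0 < T` is vacuity-idle: there is NO DLR state of `pinnedChain` at `T ≤ 0` (landed
  `Summit.AtomisticToContinuum.FouriersLaw.Theorems.AbelThermodynamicLimit.Negative.no_gibbs_of_nonpos`),
  so the crux with the guard deleted is equivalent to the crux;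
  `0 < lam`, `0 < β` (the landed proof runs for `lam, β ≥ 0` except where `exists_bmDynamics` wants
  `0 < lam`, `0 < β` for the degree bookkeeping); `hRefl : μ ∘ R⁻¹ = μ` is DERIVABLE from
  `IsChainGibbsMeasure + IsShiftInvariant` (uniqueness of the shift-invariant DLR state,
  `eq_of_isChainGibbsMeasure_of_isShiftInvariant_pinnedChain` + `IsChainGibbsMeasure.map_momentumReversalZ`,
  used below to BUILD the witness); the a.e. shift covariance `hShift` is derivable for the canonical
  dynamics and transported by rigidity. `γ` is unconstrained and idle (bath constant, not read by the
  infinite chain).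
* §5 Natural strengthenings that are NOT refutable here (recorded so nobody re-runs them):
  (ν = 0) `IntegrableOn C_T (Ioi 0)` = Green–Kubo finiteness (crux `FourierGreenKubo.GreenKubo`,
  open; false only at the excluded harmonic member `lam = β = 0`, `C ≡ C(0)`); `C_T ≥ 0` (positive
  memory, sibling crux `PositiveMemory`, open); `sup_t |C_T(t)| ≤ C_T(0)` is TRUE (positive type,
  landed `currentCorrelation_positiveType`) — not a strengthening target. No finite/decidable instance
  of the crux exists (infinite-volume objects only), so no `decide`/compute search applies.
-/

noncomputable section

namespace Summit.AtomisticToContinuum.FouriersLaw.Cruxes.HeatVarianceCalculus.Disproof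

open MeasureTheory Filter Topology Set
open Literature.MathematicalPhysics.KineticTheory.HeatConduction
open Summit.AtomisticToContinuum.FouriersLaw.Theorems.GreenKuboContinuation.TemperatureBlindVitaliHurwitz

/-! ## §1 The carrier-free junk dynamics -/

/-- The junk inhabitant of `InfiniteChainDynamics P`: empty carrier (so `mapsTo`, `flow_zero`,
`isSolution`, `unique` are vacuous), `φ₀ = id` and `φ_t = R` (momentum reversal) for `t ≠ 0`.
It is NOT a group (`φ_s ∘ φ_t ≠ φ_{s+t}`), solves no equation anywhere, yet passes every hypothesis of
the crux except `∀ᵐ σ ∂μ, σ ∈ D.carrier`. [folklore] -/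
def junkDynamics (P : OscillatorChain) : InfiniteChainDynamics P where
  carrier := ∅
  flow t σ := if t = 0 then σ else momentumReversalZ σ
  mapsTo _ σ h := absurd h (Set.notMem_empty σ)
  flow_zero σ h := absurd h (Set.notMem_empty σ)
  isSolution σ h := absurd h (Set.notMem_empty σ)
  unique _ hγ _ t := absurd (hγ t) (Set.notMem_empty _)

variable (P : OscillatorChain)

/-- `φ₀ = id`. [folklore] -/
theorem junk_flow_zero : (junkDynamics P).flow 0 = id := by
  funext σ; simp [junkDynamics]

/-- `φ_t = R` for `t ≠ 0`. [folklore] -/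
theorem junk_flow_ne {t : ℝ} (ht : t ≠ 0) : (junkDynamics P).flow t = momentumReversalZ := by
  funext σ; simp [junkDynamics, ht]

/-- Every `φ_t` of the junk dynamics preserves an `R`-invariant measure. [folklore] -/
theorem junk_measurePreserving {μ : Measure ChainConfig} (hR : μ.map momentumReversalZ = μ)
    (t : ℝ) : MeasurePreserving ((junkDynamics P).flow t) μ μ := by
  by_cases ht : t = 0
  · subst ht; rw [junk_flow_zero]; exact MeasurePreserving.id μ
  · rw [junk_flow_ne P ht]; exact ⟨momentumReversalZ.measurable, hR⟩

/-- The junk flow commutes with the shift everywhere (not only a.e.). [folklore] -/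
theorem junk_shift_comm (t : ℝ) (σ : ChainConfig) :
    (junkDynamics P).flow t (shift σ) = shift ((junkDynamics P).flow t σ) := by
  by_cases ht : t = 0
  · subst ht; simp [junk_flow_zero]
  · simp only [junk_flow_ne P ht]; exact (shift_momentumReversalZ σ).symm

/-- `C(0)` of the junk dynamics is the static sum `C₀ = ∑_x ∫ j_0 j_x dμ`. [folklore] -/
theorem junk_currentCorrelation_zero (μ : Measure ChainConfig) :
    (junkDynamics P).currentCorrelation μ 0 =
      ∑' x : ℤ, ∫ σ, P.bondCurrentZ σ 0 * P.bondCurrentZ σ x ∂μ := by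
  simp [InfiniteChainDynamics.currentCorrelation, junk_flow_zero]

/-- `C(t) = -C₀` for `t ≠ 0` (the bond current is odd under `R`). [folklore] -/
theorem junk_currentCorrelation_ne (μ : Measure ChainConfig) {t : ℝ} (ht : t ≠ 0) :
    (junkDynamics P).currentCorrelation μ t =
      -∑' x : ℤ, ∫ σ, P.bondCurrentZ σ 0 * P.bondCurrentZ σ x ∂μ := by
  simp only [InfiniteChainDynamics.currentCorrelation, junk_flow_ne P ht,
    bondCurrentZ_momentumReversalZ, mul_neg, integral_neg, tsum_neg]

/-! ## §2 Positivity of the static sum for the shift-invariant DLR state -/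

/-- For `pinnedChain ω₂ lam β γ` (`ω₂, lam, β > 0`), `T > 0` and a shift-invariant DLR state `μ`:
`0 < C₀ = ∑_x ∫ j_0 j_x dμ`. Proof: `μ` is superstable
(`hasSuperstabilityEstimate_of_isShiftInvariant_pinnedChain`), the landed Buttà–Marchioro dynamics
`D♭` preserves it (`exists_bmDynamics_pinnedChain`), `0 < D♭.currentCorrelation μ 0`
(`currentCorrelation_zero_pos`) and `D♭.currentCorrelation μ 0 = C₀` (`φ♭₀ = id` a.e.). [folklore] -/
theorem static_sum_pos {ω₂ lam β : ℝ} (γ : ℝ) (hω : 0 < ω₂) (hl : 0 < lam) (hβ : 0 < β) {T : ℝ}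
    (hT : 0 < T) {μ : Measure ChainConfig} (hμ : (pinnedChain ω₂ lam β γ).IsChainGibbsMeasure T μ)
    (hS : IsShiftInvariant μ) :
    0 < ∑' x : ℤ, ∫ σ, (pinnedChain ω₂ lam β γ).bondCurrentZ σ 0 *
      (pinnedChain ω₂ lam β γ).bondCurrentZ σ x ∂μ := by
  have hss := OscillatorChain.hasSuperstabilityEstimate_of_isShiftInvariant_pinnedChain γ hω hl.le
    hβ.le hT hμ hS
  obtain ⟨D, -, -, -, -, hpres⟩ := exists_bmDynamics_pinnedChain γ hω.le hl hβ
  have hD := hpres T μ hμ hss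
  have hU : Continuous (pinnedChain ω₂ lam β γ).U := by
    show Continuous fun q : ℝ => ω₂ * q ^ 2 / 2 + lam * q ^ 4 / 4
    fun_prop
  have hpos := currentCorrelation_zero_pos one_le_two
    (OscillatorChain.pinnedChain_U_nonneg β γ hω.le hl.le) hU
    (OscillatorChain.pinnedChain_isEvenPolyOfDegree_V ω₂ lam γ hβ)
    (pinnedChain_deriv_V_add_eq_zero γ hβ.le) D hT hμ hS hss hD
  have heq : D.currentCorrelation μ 0 = ∑' x : ℤ, ∫ σ, (pinnedChain ω₂ lam β γ).bondCurrentZ σ 0 *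
      (pinnedChain ω₂ lam β γ).bondCurrentZ σ x ∂μ := by
    unfold InfiniteChainDynamics.currentCorrelation
    exact tsum_congr fun x => integral_congr_ae (D.bondCurrentZ_mul_flow_zero_ae_eq hD x)
  rwa [heq] at hpos

/-- Momentum-reversal invariance of every shift-invariant DLR state of the pinned chain (uniqueness
of the shift-invariant DLR state + `R`-equivariance of the specification) — the crux's hypothesis
`hRefl` is derivable from the two before it. [folklore] -/
theorem map_momentumReversalZ_eq {ω₂ lam β : ℝ} (γ : ℝ) (hω : 0 < ω₂) (hl : 0 ≤ lam) (hβ : 0 ≤ β)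
    {T : ℝ} (hT : 0 < T) {μ : Measure ChainConfig}
    (hμ : (pinnedChain ω₂ lam β γ).IsChainGibbsMeasure T μ) (hS : IsShiftInvariant μ) :
    μ.map momentumReversalZ = μ := by
  have hss := OscillatorChain.hasSuperstabilityEstimate_of_isShiftInvariant_pinnedChain γ hω hl hβ
    hT hμ hS
  exact OscillatorChain.map_momentumReversalZ_eq_of_regular_unique hμ hS hss
    fun μ₁ μ₂ h₁ s₁ _ h₂ s₂ _ =>
      OscillatorChain.eq_of_isChainGibbsMeasure_of_isShiftInvariant_pinnedChain γ hω hl hβ hT h₁ s₁ h₂ s₂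

/-! ## §3 Load-bearing analysis: the carrier clause of `PreservesMeasure` -/

/-- `HeatVarianceCalculus` with `D.PreservesMeasure μ` (= `(∀ᵐ σ ∂μ, σ ∈ D.carrier) ∧
∀ t, MeasurePreserving (D.flow t) μ μ`) WEAKENED to its second clause only. [folklore] -/
def HeatVarianceCalculusWithoutCarrierAE : Prop :=
  ∀ ω₂ lam β γ : ℝ, 0 < ω₂ → 0 < lam → 0 < β → ∀ T : ℝ, 0 < T → ∀ μ : Measure ChainConfig,
    (pinnedChain ω₂ lam β γ).IsChainGibbsMeasure T μ → IsShiftInvariant μ →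
    μ.map (fun σ : ChainConfig => fun x : ℤ => ((σ x).1, -(σ x).2)) = μ →
    ∀ D : InfiniteChainDynamics (pinnedChain ω₂ lam β γ),
      (∀ t : ℝ, MeasurePreserving (D.flow t) μ μ) →
      (∀ t : ℝ, ∀ᵐ σ ∂μ, D.flow t (shift σ) = shift (D.flow t σ)) →
      (∀ t : ℝ, D.HasAbsConvergentCorrelation μ t) ∧
      Continuous (fun t : ℝ => D.currentCorrelation μ t) ∧
      ∀ V : ℝ → ℝ, V = (fun τ : ℝ => 2 * ∫ s in Set.Ioc (0:ℝ) τ, (τ - s) * D.currentCorrelation μ s) →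
        (∀ τ : ℝ, 0 ≤ τ → 0 ≤ V τ) ∧
        ∀ ν : ℝ, 0 < ν →
          IntegrableOn (fun t : ℝ => Real.exp (-(ν * t)) * D.currentCorrelation μ t) (Set.Ioi 0) ∧
          IntegrableOn (fun t : ℝ => Real.exp (-(ν * t)) * V t) (Set.Ioi 0) ∧
          ∫ t in Set.Ioi (0:ℝ), Real.exp (-(ν * t)) * D.currentCorrelation μ t =
            ν ^ 2 / 2 * ∫ t in Set.Ioi (0:ℝ), Real.exp (-(ν * t)) * V t

/-- `HeatVarianceCalculus` with the hypothesis `D.PreservesMeasure μ` DROPPED. [folklore] -/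
def HeatVarianceCalculusWithoutPreservesMeasure : Prop :=
  ∀ ω₂ lam β γ : ℝ, 0 < ω₂ → 0 < lam → 0 < β → ∀ T : ℝ, 0 < T → ∀ μ : Measure ChainConfig,
    (pinnedChain ω₂ lam β γ).IsChainGibbsMeasure T μ → IsShiftInvariant μ →
    μ.map (fun σ : ChainConfig => fun x : ℤ => ((σ x).1, -(σ x).2)) = μ →
    ∀ D : InfiniteChainDynamics (pinnedChain ω₂ lam β γ),
      (∀ t : ℝ, ∀ᵐ σ ∂μ, D.flow t (shift σ) = shift (D.flow t σ)) →
      (∀ t : ℝ, D.HasAbsConvergentCorrelation μ t) ∧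
      Continuous (fun t : ℝ => D.currentCorrelation μ t) ∧
      ∀ V : ℝ → ℝ, V = (fun τ : ℝ => 2 * ∫ s in Set.Ioc (0:ℝ) τ, (τ - s) * D.currentCorrelation μ s) →
        (∀ τ : ℝ, 0 ≤ τ → 0 ≤ V τ) ∧
        ∀ ν : ℝ, 0 < ν →
          IntegrableOn (fun t : ℝ => Real.exp (-(ν * t)) * D.currentCorrelation μ t) (Set.Ioi 0) ∧
          IntegrableOn (fun t : ℝ => Real.exp (-(ν * t)) * V t) (Set.Ioi 0) ∧
          ∫ t in Set.Ioi (0:ℝ), Real.exp (-(ν * t)) * D.currentCorrelation μ t =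
            ν ^ 2 / 2 * ∫ t in Set.Ioi (0:ℝ), Real.exp (-(ν * t)) * V t

/-- Sanity: the weakened statement implies the crux's hypothesis list is the stronger one, i.e.
`HeatVarianceCalculusWithoutCarrierAE → HeatVarianceCalculus` (so its falsity says something about
the crux's guard, not about a different statement). [folklore] -/
theorem heatVarianceCalculus_of_withoutCarrierAE (h : HeatVarianceCalculusWithoutCarrierAE) :
    Theses.CageBudgetFekete.HeatVarianceCalculus :=
  fun ω₂ lam β γ hω hl hβ T hT μ hμ hS hR D hD hsh =>
    h ω₂ lam β γ hω hl hβ T hT μ hμ hS hR D hD.2 hsh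

/-- **The carrier clause `∀ᵐ σ ∂μ, σ ∈ D.carrier` is load-bearing**: with only measure
preservation of the maps `φ_t` the statement is false. Witness: `ω₂ = lam = β = T = 1`, `γ = 0`, the
shift-invariant DLR state `μ` (`R`-invariant by `map_momentumReversalZ_eq`) and `junkDynamics`:
`C(1/(n+1)) = -C₀ → C(0) = C₀` would force `C₀ = 0`, contradicting `static_sum_pos`. [folklore] -/
theorem heatVarianceCalculus_false_without_carrierAE : ¬ HeatVarianceCalculusWithoutCarrierAE := by
  intro h
  obtain ⟨μ, hμ, hS, -⟩ :=
    OscillatorChain.exists_isChainGibbsMeasure_shiftInvariant_superstable_pinnedChain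
      (ω₂ := 1) (lam := 1) (β := 1) (0 : ℝ) one_pos zero_le_one zero_le_one (T := 1) one_pos
  have hR : μ.map momentumReversalZ = μ :=
    map_momentumReversalZ_eq 0 one_pos zero_le_one zero_le_one one_pos hμ hS
  have hR' : μ.map (fun σ : ChainConfig => fun x : ℤ => ((σ x).1, -(σ x).2)) = μ := hR
  set P := pinnedChain 1 1 1 0 with hP
  obtain ⟨-, hcont, -⟩ := h 1 1 1 0 one_pos one_pos one_pos 1 one_pos μ hμ hS hR' (junkDynamics P)
    (junk_measurePreserving P hR) (fun t => Eventually.of_forall (junk_shift_comm P t))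
  have hpos := static_sum_pos (ω₂ := 1) (lam := 1) (β := 1) 0 one_pos one_pos one_pos one_pos hμ hS
  set C₀ := ∑' x : ℤ, ∫ σ, P.bondCurrentZ σ 0 * P.bondCurrentZ σ x ∂μ with hC₀
  have h1 : Tendsto (fun n : ℕ => (junkDynamics P).currentCorrelation μ (1 / ((n : ℝ) + 1)))
      atTop (𝓝 ((junkDynamics P).currentCorrelation μ 0)) :=
    (hcont.tendsto 0).comp tendsto_one_div_add_atTop_nhds_zero_nat
  have h2 : (fun n : ℕ => (junkDynamics P).currentCorrelation μ (1 / ((n : ℝ) + 1))) =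
      fun _ => -C₀ := by
    funext n
    exact junk_currentCorrelation_ne P μ (by positivity)
  rw [h2, junk_currentCorrelation_zero] at h1
  have h3 : C₀ = -C₀ := tendsto_nhds_unique h1 tendsto_const_nhds
  linarith

/-- Corollary: dropping `D.PreservesMeasure μ` altogether is (a fortiori) false. [folklore] -/
theorem heatVarianceCalculus_false_without_preservesMeasure :
    ¬ HeatVarianceCalculusWithoutPreservesMeasure :=
  fun h => heatVarianceCalculus_false_without_carrierAE
    fun ω₂ lam β γ hω hl hβ T hT μ hμ hS hR D _ hsh => h ω₂ lam β γ hω hl hβ T hT μ hμ hS hR D hsh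

/-- The same junk breaks clause (c) too: its heat variance at `τ = 1` is `V(1) = -C₀ < 0`
(`C = -C₀` on `(0,1]`, `2∫₀¹(1-s)ds = 1`). So `V ≥ 0` is a property of the Koopman GROUP of a
carried flow (positive type of `C_T`), not of the static Gibbs data. [folklore] -/
theorem junk_heatVariance_one_neg {ω₂ lam β : ℝ} (γ : ℝ) (hω : 0 < ω₂) (hl : 0 < lam) (hβ : 0 < β)
    {T : ℝ} (hT : 0 < T) {μ : Measure ChainConfig}
    (hμ : (pinnedChain ω₂ lam β γ).IsChainGibbsMeasure T μ) (hS : IsShiftInvariant μ) :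
    2 * ∫ s in Set.Ioc (0:ℝ) 1, (1 - s) *
      (junkDynamics (pinnedChain ω₂ lam β γ)).currentCorrelation μ s < 0 := by
  set P := pinnedChain ω₂ lam β γ with hP
  set C₀ := ∑' x : ℤ, ∫ σ, P.bondCurrentZ σ 0 * P.bondCurrentZ σ x ∂μ with hC₀
  have hpos : 0 < C₀ := static_sum_pos γ hω hl hβ hT hμ hS
  have hcongr : ∫ s in Set.Ioc (0:ℝ) 1, (1 - s) * (junkDynamics P).currentCorrelation μ s =
      ∫ s in Set.Ioc (0:ℝ) 1, (1 - s) * (-C₀) := by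
    refine setIntegral_congr_fun measurableSet_Ioc fun s hs => ?_
    rw [junk_currentCorrelation_ne P μ hs.1.ne']
  have hval : ∫ s in Set.Ioc (0:ℝ) 1, (1 - s) * (-C₀) = -C₀ / 2 := by
    rw [integral_mul_const, ← intervalIntegral.integral_of_le zero_le_one,
      intervalIntegral.integral_sub intervalIntegrable_const intervalIntegral.intervalIntegrable_id,
      intervalIntegral.integral_const, integral_id]
    ring
  rw [hcongr, hval]
  linarith

end Summit.AtomisticToContinuum.FouriersLaw.Cruxes.HeatVarianceCalculus.Disproof

end
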